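import Mathlib.Analysis.SpecialFunctions.Exp
import Mathlib.RingTheory.AlgebraicIndependent.Transcendental
import Mathlib.FieldTheory.IntermediateField.Adjoin.Basic
import Mathlib.LinearAlgebra.Quotient.Basic
import Literature.NumberTheory.Transcendental.ZilberField
import HarnessLib

/-!
# Kirby's weak Schanuel property of `ℂ_exp` over the exponential-algebraic closure of `∅`

One NAMED FACT (D-0014) for route `Schanuel/EclCore` (item `stmt-Schanuel-0068`).

For an exponential field `F` and an `ecl`-closed subset `C ⊆ F` (`ecl` = exponential-algebraic
closure, `Literature.NumberTheory.Transcendental.ecl`, Kirby 2010 Def. 1.1 via Khovanskii systems), Kirby's *weak Schanuel property*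
(Kirby, Bull. Lond. Math. Soc. 42 (2010) 879–890, Thm. 1.2, proved algebraically from Ax's
theorem, J. Ax, Ann. of Math. 93 (1971), Thm. 3) reads
`td(x, exp x / C) − ldim_ℚ(x / C) ≥ dim(x / C)` for every tuple `x`, where `dim` is the dimension
of the pregeometry `ecl` (ibid. Thm. 1.1). We record the special case `F = ℂ_exp`,
`C = ecl(∅)` with the (non-negative) right-hand side dropped: if `x₁, …, xₙ ∈ ℂ` are
`ℚ`-linearly independent modulo the `ℚ`-span of `E = ecl(∅)` then
`trdeg_{ℚ(E)} ℚ(E)(x, eˣ) ≥ n`. This is WEAKER than the printed theorem (special case, weaker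
conclusion) and is exactly the input of Kirby's corollary "essential counterexamples to Schanuel's
conjecture lie in `ecl(∅)`" (ibid. §1).

Rendering: "`ℚ`-linearly independent modulo `span_ℚ E`" is linear independence of the images in
the quotient module `ℂ ⧸ span_ℚ E` (`Submodule.mkQ`); `ℚ(E)` is `IntermediateField.adjoin ℚ E`
and the transcendence degree is `Algebra.trdeg` of the further adjunction of
`range x ∪ range (exp ∘ x)`.

## References

* J. Kirby, *Exponential algebraicity in exponential fields*, Bull. Lond. Math. Soc. 42 (2010),
  879–890 (arXiv:0810.4285), Thms. 1.1–1.2 and the Corollary in §1.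
* J. Ax, *On Schanuel's conjectures*, Ann. of Math. 93 (1971), 252–268, Thm. 3.
-/

noncomputable section

namespace Literature.NumberTheory.Transcendental

/-- **Kirby's weak Schanuel property over `ecl(∅)`** (Kirby, Bull. LMS 42 (2010), Thm. 1.2,
special case `F = ℂ_exp`, `C = ecl(∅)`, dropping the non-negative pregeometry-dimension term;
from Ax 1971, Thm. 3). If `x : Fin n → ℂ` is `ℚ`-linearly independent modulo the `ℚ`-span of
`E = Literature.ecl ∅` (the exponential-algebraic closure of `∅` in `ℂ`), then the transcendence degree of
`ℚ(E)(x₁, …, xₙ, e^{x₁}, …, e^{xₙ})` over `ℚ(E)` is at least `n`. Named fact (D-0014); weaker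
than the printed statement. [cite: Kirby2010, Thm. 1.2; Ax1971, Thm. 3] -/
def kirby_weakSchanuel_ecl_empty : Prop :=
  ∀ (n : ℕ) (x : Fin n → ℂ),
    LinearIndependent ℚ ((Submodule.span ℚ (Literature.NumberTheory.Transcendental.ecl (∅ : Set ℂ))).mkQ ∘ x) →
      (n : Cardinal) ≤ Algebra.trdeg ↥(IntermediateField.adjoin ℚ (Literature.NumberTheory.Transcendental.ecl (∅ : Set ℂ)))
        ↥(IntermediateField.adjoin ↥(IntermediateField.adjoin ℚ (Literature.NumberTheory.Transcendental.ecl (∅ : Set ℂ)))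
          (Set.range x ∪ Set.range (Complex.exp ∘ x)))

end Literature.NumberTheory.Transcendental
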